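import Mathlib
import HarnessLib
import Literature.MathematicalPhysics.QuantumLattice.KohnLuttinger
import Literature.MathematicalPhysics.QuantumLattice.KohnLuttingerChannelStates
import Literature.MathematicalPhysics.QuantumLattice.KohnLuttingerLindhardMeasurable
import Summits.HubbardSuperconductivity.HubbardSuperconductivity.Theorems.WeakCouplingBCSWcbcsKohnLuttingerB1gReduction
import Summits.HubbardSuperconductivity.HubbardSuperconductivity.Theorems.WeakCouplingBCSKlCertTPrimePHReflection
import Summits.HubbardSuperconductivity.HubbardSuperconductivity.Theorems.WeakCouplingBCSKlSublatticeDeckShift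
import Summits.HubbardSuperconductivity.HubbardSuperconductivity.Theorems.WeakCouplingBCSWcbcsKohnLuttingerB1gSublatticeDuality

/-!
# The `(π, 0)`-flip of the zone: the pure `t'` band does not see the sign of `t'` at the level of the Lindhard function,
# the kernel and the Fermi-curve measure («(KLSCAN)-SUBLATTICE-DUALITY-DISCHARGE» part 10, toward S3 `ChannelInfNNNSign`;
# cell gate-hubbard-kl, seat p4 g20)

`squareDispersion 0 (-1) = -squareDispersion 0 1 = (squareDispersion 0 1) ∘ T₁` on the zone, where `T₁ = klslFlip` is p4 g19's
half-period swap `klphTau` in the first coordinate only (the translation by `(π, 0)` modulo `2πℤ²`):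

* §18 `klslFlip`: measurable, Lebesgue-preserving involution of momentum space mapping the zone onto itself;
  `klsl_squareDispersion_flip(_add)`, `klslFlip_preimage_fermiCurve : T₁⁻¹ F[ε', μ] = F[-ε', μ]`;
* §19 **`klsl_lindhardFunction_negSign : χ₀[squareDispersion 0 (-1), μ] = χ₀[squareDispersion 0 1, μ]`** (all `μ, q`),
  `klsl_kohnLuttingerKernel_negSign` (the kernels are EQUAL as functions), `klsl_lindhardFunction_nnn_add_vec` (`2πℤ²`-periodicity),
  `klsl_kernel_nnn_flip : Γ'(T₁u, T₁u') = Γ'(u, u')` on the zone;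
* §20 `klsl_hausdorffMeasure_image_flip`, **`klsl_measurePreserving_flip_fermi : T₁_* σ[-ε', μ] = σ[ε', μ]`** and `…_fermi'`
  (the reverse);
* §21 the flip TWISTS the point group by the deck shift: `T₁ (r k) = D (r (T₁ k))` on g19's good set, `T₁ (s k) = s (T₁ k)`;
  for DECK-EVEN functions `g` (`g ∘ D = g` on the good set) the isotypic projections still intertwine
  (`klsl_d4Project_flip`) and `g ∈ χ ⇒ 𝟙_G · (g ∘ T₁) ∈ χ` (`klsl_inChannel_flip`).

Honest framing: exact symmetry bookkeeping for a free band; S3 itself (equality of the channel bottoms of `squareDispersion 0 (±1)`)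
is NOT proved in this file; nothing asserts a margin, the window, `K₃` or superconductivity.
-/

noncomputable section

set_option linter.dupNamespace false

namespace Summit.HubbardSuperconductivity.HubbardSuperconductivity.Theorems

open MeasureTheory Real Set Literature.MathematicalPhysics.QuantumLattice
open scoped ENNReal Pointwise

/-! ### §18 The `(π, 0)`-flip `T₁` of the zone: `ε' ∘ T₁ = -ε' = squareDispersion 0 (-1)` -/

/-- The **`(π, 0)`-flip** of the half-open zone: the half-period swap `klphTau` (p4 g19) in the FIRST coordinate only.  On the
zone it is the translation by `(π, 0)` modulo `2πℤ²`; it flips the sign of the pure `t'` band. [folklore] -/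
def klslFlip (k : Momentum) : Momentum := WithLp.toLp 2 ![klphTau (k 0), k 1]

/-- First component of the flip. [folklore] -/
@[simp] theorem klslFlip_apply_zero (k : Momentum) : klslFlip k 0 = klphTau (k 0) := by simp [klslFlip]

/-- Second component of the flip. [folklore] -/
@[simp] theorem klslFlip_apply_one (k : Momentum) : klslFlip k 1 = k 1 := by simp [klslFlip]

/-- The flip is an involution. [folklore] -/
theorem klslFlip_klslFlip (k : Momentum) : klslFlip (klslFlip k) = k := by
  ext i; fin_cases i <;> simp [klphTau_klphTau]

/-- The flip as `Function.Involutive`. [folklore] -/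
theorem klslFlip_involutive : Function.Involutive klslFlip := klslFlip_klslFlip

/-- The flip, factored through the measurable equivalence `Momentum ≃ᵐ (Fin 2 → ℝ)`. [folklore] -/
theorem klslFlip_eq_comp :
    klslFlip = (WithLp.toLp 2) ∘ (fun (a : Fin 2 → ℝ) (i : Fin 2) => (if i = 0 then klphTau else id) (a i)) ∘ (WithLp.ofLp) := by
  funext k
  ext i
  fin_cases i <;> simp [klslFlip]

/-- **The flip preserves Lebesgue measure on momentum space.** [folklore] -/
theorem klsl_measurePreserving_flip : MeasurePreserving klslFlip volume volume := by
  rw [klslFlip_eq_comp]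
  refine (PiLp.volume_preserving_toLp (Fin 2)).comp ((volume_preserving_pi fun i : Fin 2 => ?_).comp
    (PiLp.volume_preserving_ofLp (Fin 2)))
  by_cases hi : i = 0
  · simp only [hi, if_true]; exact klph_measurePreserving_tau
  · simp only [hi, if_false]; exact MeasurePreserving.id volume

/-- The flip is Borel measurable. [folklore] -/
theorem klsl_measurable_flip : Measurable klslFlip := klsl_measurePreserving_flip.measurable

/-- The flip is a measurable embedding (a measurable involution). [folklore] -/
theorem klsl_measurableEmbedding_flip : MeasurableEmbedding klslFlip :=
  (MeasurableEquiv.ofInvolutive klslFlip klslFlip_involutive klsl_measurable_flip).measurableEmbedding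

/-- `T₁ k ∈ BZ ↔ k ∈ BZ`. [folklore] -/
theorem klslFlip_mem_brillouinZone_iff (k : Momentum) : klslFlip k ∈ brillouinZone ↔ k ∈ brillouinZone := by
  simp only [brillouinZone, mem_setOf_eq, Fin.forall_fin_two, klslFlip_apply_zero, klslFlip_apply_one, klphTau_mem_Ico_iff]

/-- `T₁ ⁻¹' BZ = BZ`. [folklore] -/
theorem klslFlip_preimage_brillouinZone : klslFlip ⁻¹' brillouinZone = brillouinZone :=
  Set.ext klslFlip_mem_brillouinZone_iff

/-- The flip preserves Lebesgue measure restricted to the zone. [folklore] -/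
theorem klsl_measurePreserving_flip_restrict :
    MeasurePreserving klslFlip (volume.restrict brillouinZone) (volume.restrict brillouinZone) := by
  have h := klsl_measurePreserving_flip.restrict_preimage measurableSet_brillouinZone
  rwa [klslFlip_preimage_brillouinZone] at h

/-- Preimages under the involution `T₁` are images. [folklore] -/
theorem klslFlip_preimage_eq_image (s : Set Momentum) : klslFlip ⁻¹' s = klslFlip '' s :=
  (Set.image_eq_preimage_of_inverse klslFlip_involutive.leftInverse klslFlip_involutive.rightInverse ▸ rfl :
    klslFlip '' s = klslFlip ⁻¹' s).symm

/-- **On the zone the flip realises the sign change**: `ε'(T₁ k) = -ε'(k) = squareDispersion 0 (-1) k` for `k ∈ BZ`. [folklore] -/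
theorem klsl_squareDispersion_flip {k : Momentum} (hk : k ∈ brillouinZone) :
    squareDispersion 0 1 (klslFlip k) = squareDispersion 0 (-1) k := by
  simp only [squareDispersion, klslFlip_apply_zero, klslFlip_apply_one, cos_klphTau (hk 0)]
  ring

/-- … and after a translation: `ε'(T₁ p + q) = squareDispersion 0 (-1) (p + q)` for `p ∈ BZ`. [folklore] -/
theorem klsl_squareDispersion_flip_add {p : Momentum} (hp : p ∈ brillouinZone) (q : Momentum) :
    squareDispersion 0 1 (klslFlip p + q) = squareDispersion 0 (-1) (p + q) := by
  have h0 : cos ((klslFlip p + q) 0) = -cos ((p + q) 0) := by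
    simp only [PiLp.add_apply, klslFlip_apply_zero]
    rcases klphTau_eq_add_pi_or (hp 0) with h | h
    · rw [h, show p 0 + π + q 0 = (p 0 + q 0) + π by ring, cos_add_pi]
    · rw [h, show p 0 - π + q 0 = (p 0 + q 0) - π by ring, cos_sub_pi]
  have h1 : (klslFlip p + q) 1 = (p + q) 1 := by simp only [PiLp.add_apply, klslFlip_apply_one]
  simp only [squareDispersion, h0, h1]
  ring

/-- `T₁ ⁻¹' F[ε', μ] = F[squareDispersion 0 (-1), μ]`. [folklore] -/
theorem klslFlip_preimage_fermiCurve (μ : ℝ) :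
    klslFlip ⁻¹' fermiCurve (squareDispersion 0 1) μ = fermiCurve (squareDispersion 0 (-1)) μ := by
  ext k
  simp only [mem_preimage, fermiCurve, mem_setOf_eq, klslFlip_mem_brillouinZone_iff]
  constructor
  · rintro ⟨hk, h⟩; exact ⟨hk, by rwa [klsl_squareDispersion_flip hk] at h⟩
  · rintro ⟨hk, h⟩; exact ⟨hk, by rwa [klsl_squareDispersion_flip hk]⟩

/-! ### §19 The Lindhard function does not see the sign of `t'` -/

/-- Pointwise: `L[squareDispersion 0 (-1), μ](q, p) = L[ε', μ](q, T₁ p)` for `p ∈ BZ`. [folklore] -/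
theorem klsl_lindhardIntegrand_flip (μ : ℝ) (q : Momentum) {p : Momentum} (hp : p ∈ brillouinZone) :
    lindhardIntegrand (squareDispersion 0 1) μ q (klslFlip p) = lindhardIntegrand (squareDispersion 0 (-1)) μ q p := by
  simp only [lindhardIntegrand, fermiOccupation, klsl_squareDispersion_flip hp, klsl_squareDispersion_flip_add hp]

/-- **The Lindhard function of the pure `t'` band is even in `t'`**: `χ₀[squareDispersion 0 (-1), μ] = χ₀[squareDispersion 0 1, μ]`
for every `μ` (substitute `p ↦ T₁ p` on the zone; Bochner junk values included). [folklore] -/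
theorem klsl_lindhardFunction_negSign (μ : ℝ) (q : Momentum) :
    lindhardFunction (squareDispersion 0 (-1)) μ q = lindhardFunction (squareDispersion 0 1) μ q := by
  unfold lindhardFunction
  congr 1
  have h := klsl_measurePreserving_flip_restrict.integral_comp klsl_measurableEmbedding_flip
    (lindhardIntegrand (squareDispersion 0 1) μ q)
  rw [← h]
  refine integral_congr_ae ((ae_restrict_iff' measurableSet_brillouinZone).2 (Filter.Eventually.of_forall ?_))
  intro p hp
  exact (klsl_lindhardIntegrand_flip μ q hp).symm

/-- … hence the Kohn–Luttinger kernels agree: `Γ[squareDispersion 0 (-1), μ, U] = Γ[squareDispersion 0 1, μ, U]`. [folklore] -/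
theorem klsl_kohnLuttingerKernel_negSign (μ U : ℝ) :
    kohnLuttingerKernel (squareDispersion 0 (-1)) μ U = kohnLuttingerKernel (squareDispersion 0 1) μ U := by
  funext k k'
  rw [kohnLuttingerKernel, kohnLuttingerKernel, klsl_lindhardFunction_negSign]

/-- The Lindhard function of the pure `t'` band is `2πℤ²`-periodic in the transfer. [folklore] -/
theorem klsl_lindhardFunction_nnn_add_vec (μ : ℝ) (q : Momentum) {a b : ℝ} (ha : ∃ m : ℤ, a = m * (2 * π))
    (hb : ∃ n : ℤ, b = n * (2 * π)) :
    lindhardFunction (squareDispersion 0 1) μ (q + klslVec a b) = lindhardFunction (squareDispersion 0 1) μ q := by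
  obtain ⟨m, rfl⟩ := ha
  obtain ⟨n, rfl⟩ := hb
  refine klph_lindhardFunction_congr μ fun p => ?_
  simp only [squareDispersion, PiLp.add_apply, klslVec_apply_zero, klslVec_apply_one, ← add_assoc,
    Real.cos_add_int_mul_two_pi]

/-- **The kernel of the pure `t'` band is flip-invariant**: `Γ'(T₁ u, T₁ u') = Γ'(u, u')` for `u, u' ∈ BZ`
(`T₁ u + T₁ u' = u + u' + (a, 0)`, `a ∈ {0, ±2π}`). [folklore] -/
theorem klsl_kernel_nnn_flip {μ : ℝ} (U : ℝ) {u u' : Momentum} (hu : u ∈ brillouinZone) (hu' : u' ∈ brillouinZone) :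
    kohnLuttingerKernel (squareDispersion 0 1) μ U (klslFlip u) (klslFlip u') =
      kohnLuttingerKernel (squareDispersion 0 1) μ U u u' := by
  have key : ∃ a : ℝ, (∃ m : ℤ, a = m * (2 * π)) ∧ klslFlip u + klslFlip u' = (u + u') + klslVec a 0 := by
    refine ⟨klphTau (u 0) - u 0 + (klphTau (u' 0) - u' 0), ?_, ?_⟩
    · rcases klphTau_eq_add_pi_or (hu 0) with h | h <;> rcases klphTau_eq_add_pi_or (hu' 0) with h' | h'
      · exact ⟨1, by rw [h, h']; ring⟩
      · exact ⟨0, by rw [h, h']; ring⟩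
      · exact ⟨0, by rw [h, h']; ring⟩
      · exact ⟨-1, by rw [h, h']; simp; ring⟩
    · ext i; fin_cases i
      · simp; ring
      · simp
  obtain ⟨a, ha, h⟩ := key
  rw [kohnLuttingerKernel, kohnLuttingerKernel, h, klsl_lindhardFunction_nnn_add_vec μ _ ha ⟨0, by simp⟩]

/-! ### §20 The flip pushes the Fermi-curve measure of `-ε'` to that of `ε'` -/

/-- Arc length of subsets of the zone is flip-invariant (on the two halves `k₀ < 0`, `k₀ ≥ 0` the flip is a translation
by `(±π, 0)`). [folklore] -/
theorem klsl_hausdorffMeasure_image_flip_le {B : Set Momentum} (hB : B ⊆ brillouinZone) :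
    μH[1] (klslFlip '' B) ≤ μH[1] B := by
  have hH0 : MeasurableSet {k : Momentum | k 0 < 0} := measurableSet_lt klsl_measurable_fst measurable_const
  have h1 : EqOn klslFlip (fun k => k + klslVec π 0) (B ∩ {k | k 0 < 0}) := fun k ⟨hk, h0⟩ => by
    ext i; fin_cases i
    · simp [klphTau_of_mem_left ⟨(hB hk 0).1, h0⟩]
    · simp
  have h2 : EqOn klslFlip (fun k => k + klslVec (-π) 0) (B \ {k | k 0 < 0}) := fun k ⟨hk, h0⟩ => by
    ext i; fin_cases i
    · simp [klphTau_of_mem_right ⟨not_lt.1 h0, (hB hk 0).2⟩]; ring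
    · simp
  calc μH[1] (klslFlip '' B) = μH[1] (klslFlip '' (B ∩ {k | k 0 < 0}) ∪ klslFlip '' (B \ {k | k 0 < 0})) := by
        rw [← image_union, inter_union_sdiff]
    _ ≤ μH[1] (klslFlip '' (B ∩ {k | k 0 < 0})) + μH[1] (klslFlip '' (B \ {k | k 0 < 0})) := measure_union_le _ _
    _ = μH[1] (B ∩ {k | k 0 < 0}) + μH[1] (B \ {k | k 0 < 0}) := by
        rw [h1.image_eq, h2.image_eq, klph_hausdorffMeasure_image_add_right, klph_hausdorffMeasure_image_add_right]
    _ = μH[1] B := measure_inter_add_sdiff _ hH0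

/-- `μH[1] (T₁ '' B) = μH[1] B` for `B ⊆ BZ`. [folklore] -/
theorem klsl_hausdorffMeasure_image_flip {B : Set Momentum} (hB : B ⊆ brillouinZone) :
    μH[1] (klslFlip '' B) = μH[1] B := by
  refine le_antisymm (klsl_hausdorffMeasure_image_flip_le hB) ?_
  have hB' : klslFlip '' B ⊆ brillouinZone := by
    rintro _ ⟨k, hk, rfl⟩; exact (klslFlip_mem_brillouinZone_iff k).2 (hB hk)
  have h := klsl_hausdorffMeasure_image_flip_le hB'
  rwa [klslFlip_involutive.leftInverse.image_image] at h

/-- The flip is measure preserving between arc length on `F[-ε', μ]` and on `F[ε', μ]`. [folklore] -/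
theorem klsl_measurePreserving_flip_hausdorff (μ : ℝ) :
    MeasurePreserving klslFlip
      ((μH[1] : Measure Momentum).restrict (fermiCurve (squareDispersion 0 (-1)) μ))
      ((μH[1] : Measure Momentum).restrict (fermiCurve (squareDispersion 0 1) μ)) := by
  refine ⟨klsl_measurable_flip, Measure.ext fun A hA => ?_⟩
  rw [Measure.map_apply klsl_measurable_flip hA, Measure.restrict_apply (klsl_measurable_flip hA),
    Measure.restrict_apply hA, ← klslFlip_preimage_fermiCurve μ, ← preimage_inter, klslFlip_preimage_eq_image]
  exact klsl_hausdorffMeasure_image_flip (fun k hk => hk.2.1)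

/-- `∇(squareDispersion 0 (-1)) = -∇ε'` and `∇ε'(T₁ k) = -∇ε'(k)` on the zone: the density of states is flip-invariant. [folklore] -/
theorem klsl_density_flip {k : Momentum} (hk : k ∈ brillouinZone) :
    ENNReal.ofReal (‖gradient (squareDispersion 0 (-1)) k‖⁻¹) =
      ENNReal.ofReal (‖gradient (squareDispersion 0 1) (klslFlip k)‖⁻¹) := by
  have h1 : gradient (squareDispersion 0 (-1)) k = -gradient (squareDispersion 0 1) k := by
    rw [klsl_gradient_squareDispersion, klsl_gradient_squareDispersion]
    ext i; fin_cases i <;> simp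
  have h2 : gradient (squareDispersion 0 1) (klslFlip k) = -gradient (squareDispersion 0 1) k := by
    rw [klsl_gradient_squareDispersion, klsl_gradient_squareDispersion]
    ext i; fin_cases i <;> simp [sin_klphTau (hk 0), cos_klphTau (hk 0)]
  rw [h1, h2]

/-- **`T₁_* σ[squareDispersion 0 (-1), μ] = σ[squareDispersion 0 1, μ]`.** [folklore] -/
theorem klsl_measurePreserving_flip_fermi (μ : ℝ) :
    MeasurePreserving klslFlip (fermiCurveMeasure (squareDispersion 0 (-1)) μ) (fermiCurveMeasure (squareDispersion 0 1) μ) := by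
  refine ⟨klsl_measurable_flip, ?_⟩
  have hmp := klsl_measurePreserving_flip_hausdorff μ
  have hF := measurableSet_fermiCurve (measurable_squareDispersion 0 (-1)) μ
  have hae : (fun k => ENNReal.ofReal (‖gradient (squareDispersion 0 (-1)) k‖⁻¹)) =ᵐ[(μH[1] : Measure Momentum).restrict
      (fermiCurve (squareDispersion 0 (-1)) μ)]
      (fun k => ENNReal.ofReal (‖gradient (squareDispersion 0 1) k‖⁻¹)) ∘ klslFlip := by
    filter_upwards [ae_restrict_mem hF] with k hk
    exact klsl_density_flip hk.1
  unfold fermiCurveMeasure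
  rw [withDensity_congr_ae hae]
  exact klph_map_withDensity_comp_equiv (MeasurableEquiv.ofInvolutive klslFlip klslFlip_involutive klsl_measurable_flip) hmp _

/-- … and back: `T₁_* σ[ε', μ] = σ[-ε', μ]` (involution). [folklore] -/
theorem klsl_measurePreserving_flip_fermi' (μ : ℝ) :
    MeasurePreserving klslFlip (fermiCurveMeasure (squareDispersion 0 1) μ) (fermiCurveMeasure (squareDispersion 0 (-1)) μ) := by
  refine ⟨klsl_measurable_flip, ?_⟩
  have h := (klsl_measurePreserving_flip_fermi μ).map_eq
  conv_lhs => rw [← h, Measure.map_map klsl_measurable_flip klsl_measurable_flip]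
  have hid : klslFlip ∘ klslFlip = id := funext klslFlip_klslFlip
  rw [hid, Measure.map_id]

/-! ### §21 The flip and the point group: a twist by the deck shift -/

/-- The flip maps g19's good set into itself. [folklore] -/
theorem klsl_klslFlip_mem_klphGood {k : Momentum} (hk : k ∈ klphGood) : klslFlip k ∈ klphGood := by
  have h := hk 0
  have h1 := hk 1
  have habs := abs_lt.1 h.2
  have hne : k 0 ≠ 0 := abs_pos.1 h.1
  rw [klphGood, mem_setOf_eq, Fin.forall_fin_two, klslFlip_apply_zero, klslFlip_apply_one]
  refine ⟨?_, h1⟩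
  rcases lt_or_gt_of_ne hne with hneg | hpos
  · rw [klphTau_of_mem_left ⟨habs.1.le, hneg⟩]
    exact ⟨abs_pos.2 (by linarith), abs_lt.2 ⟨by linarith, by linarith⟩⟩
  · rw [klphTau_of_mem_right ⟨hpos.le, habs.2⟩]
    exact ⟨abs_pos.2 (by linarith), abs_lt.2 ⟨by linarith [pi_pos], by linarith⟩⟩

/-- **On the good set the flip twists the quarter turn by the deck shift**: `T₁ (r k) = D (r (T₁ k))`. [folklore] -/
theorem klslFlip_rotMomentum {k : Momentum} (hk : k ∈ klphGood) :
    klslFlip (rotMomentum k) = klphShift (rotMomentum (klslFlip k)) := by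
  ext i; fin_cases i
  · simp [rotMomentum, klphTau_neg_of_abs (hk 1).1 (hk 1).2]
  · simp [rotMomentum, klphTau_klphTau]

/-- The flip commutes with the reflection. [folklore] -/
theorem klslFlip_reflMomentum (k : Momentum) : klslFlip (reflMomentum k) = reflMomentum (klslFlip k) := by
  ext i; fin_cases i <;> simp [reflMomentum]

/-- **Intertwining of the isotypic projections along the flip, for deck-even functions**: if `g ∘ D = g` on the good set
`G`, then `P_χ (𝟙_G · (g ∘ T₁)) (k) = (P_χ g)(T₁ k)` for `k ∈ G` (the deck twists picked up by the odd rotations are absorbed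
by `g`). [folklore] -/
theorem klsl_d4Project_flip (χ : D4Irrep) {g : Momentum → ℝ} (hg : ∀ k ∈ klphGood, g (klphShift k) = g k)
    {k : Momentum} (hk : k ∈ klphGood) :
    d4Project χ (klphGood.indicator (g ∘ klslFlip)) k = d4Project χ g (klslFlip k) := by
  have hG : ∀ {q : Momentum}, q ∈ klphGood → rotMomentum q ∈ klphGood := fun h => (rotMomentum_mem_klphGood_iff _).2 h
  have hS : ∀ {q : Momentum}, q ∈ klphGood → reflMomentum q ∈ klphGood := fun h => (reflMomentum_mem_klphGood_iff _).2 h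
  have hT : ∀ {q : Momentum}, q ∈ klphGood → klslFlip q ∈ klphGood := fun h => klsl_klslFlip_mem_klphGood h
  set u := klslFlip k with hu
  have hu' : u ∈ klphGood := hT hk
  -- the images of the eight points
  have e1 : g (klslFlip (rotMomentum k)) = g (rotMomentum u) := by
    rw [klslFlip_rotMomentum hk, hg _ (hG hu')]
  have e2 : g (klslFlip (rotMomentum (rotMomentum k))) = g (rotMomentum (rotMomentum u)) := by
    rw [klslFlip_rotMomentum (hG hk), klslFlip_rotMomentum hk, ← klphShift_rotMomentum (hG hu'), klphShift_klphShift]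
  have e3 : g (klslFlip (rotMomentum (rotMomentum (rotMomentum k)))) = g (rotMomentum (rotMomentum (rotMomentum u))) := by
    rw [klslFlip_rotMomentum (hG (hG hk)), klslFlip_rotMomentum (hG hk), klslFlip_rotMomentum hk,
      ← klphShift_rotMomentum (hG hu'), klphShift_klphShift, hg _ (hG (hG (hG hu')))]
  have f0 : g (klslFlip (reflMomentum k)) = g (reflMomentum u) := by rw [klslFlip_reflMomentum]
  have f1 : g (klslFlip (reflMomentum (rotMomentum k))) = g (reflMomentum (rotMomentum u)) := by
    rw [klslFlip_reflMomentum, klslFlip_rotMomentum hk, ← klphShift_reflMomentum (hG hu'), hg _ (hS (hG hu'))]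
  have f2 : g (klslFlip (reflMomentum (rotMomentum (rotMomentum k)))) = g (reflMomentum (rotMomentum (rotMomentum u))) := by
    rw [klslFlip_reflMomentum, klslFlip_rotMomentum (hG hk), klslFlip_rotMomentum hk, ← klphShift_rotMomentum (hG hu'),
      klphShift_klphShift]
  have f3 : g (klslFlip (reflMomentum (rotMomentum (rotMomentum (rotMomentum k))))) =
      g (reflMomentum (rotMomentum (rotMomentum (rotMomentum u)))) := by
    rw [klslFlip_reflMomentum, klslFlip_rotMomentum (hG (hG hk)), klslFlip_rotMomentum (hG hk), klslFlip_rotMomentum hk,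
      ← klphShift_rotMomentum (hG hu'), klphShift_klphShift, ← klphShift_reflMomentum (hG (hG (hG hu'))),
      hg _ (hS (hG (hG (hG hu'))))]
  have hk1 := hG hk
  have hk2 := hG hk1
  have hk3 := hG hk2
  simp only [d4Project, sum_dihedralGroup_four, d4Momentum_r_zero, d4Momentum_r_one, d4Momentum_r_two,
    d4Momentum_r_three, d4Momentum_sr_zero, d4Momentum_sr_one, d4Momentum_sr_two, d4Momentum_sr_three,
    Set.indicator_of_mem hk, Set.indicator_of_mem hk1, Set.indicator_of_mem hk2, Set.indicator_of_mem hk3,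
    Set.indicator_of_mem (hS hk), Set.indicator_of_mem (hS hk1), Set.indicator_of_mem (hS hk2), Set.indicator_of_mem (hS hk3),
    Function.comp_apply, ← hu, e1, e2, e3, f0, f1, f2, f3]

/-- **Deck-even channel functions transport along the flip**: if `g ∈ χ` and `g ∘ D = g` on the good set, then
`𝟙_G · (g ∘ T₁) ∈ χ` (pointwise, everywhere). [cite: RaghuKivelsonScalapino2010, §III (17)] -/
theorem klsl_inChannel_flip {χ : D4Irrep} {g : Momentum → ℝ} (h : InChannel χ g)
    (hg : ∀ k ∈ klphGood, g (klphShift k) = g k) : InChannel χ (klphGood.indicator (g ∘ klslFlip)) := by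
  funext k
  by_cases hk : k ∈ klphGood
  · rw [klsl_d4Project_flip χ hg hk, Set.indicator_of_mem hk, Function.comp_apply]
    exact congrFun h (klslFlip k)
  · simp only [d4Project, Set.indicator_of_notMem hk]
    rw [Finset.sum_eq_zero (fun γ _ => ?_), mul_zero]
    rw [Set.indicator_of_notMem (fun h' => hk ((d4Momentum_mem_klphGood_iff γ k).1 h')), mul_zero]

end Summit.HubbardSuperconductivity.HubbardSuperconductivity.Theorems

end
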